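import Summits.QuantumFields.YangMills.Theorems.ColdStartUniversalityShenZhuZhuPlaquetteSusceptibilitySUN
import Literature.MathematicalPhysics.QuantumLattice.WilsonFeynmanHellmann
import Literature.MathematicalPhysics.QuantumFieldTheory.WilsonPlaquettePositivity
import Literature.MathematicalPhysics.QuantumLattice.TwistEaterIrreducibility
import Literature.MathematicalPhysics.QuantumLattice.StaggeredGaugeExpectationZeroCoupling
import HarnessLib

/-!
# The COUPLING RESPONSE of the plaquette: `d⟨Re Tr Q_p⟩_b/db = Σ_q Cov_b(Re Tr Q_p, Re Tr Q_q)` (Feynman–Hellmann) — hence, for every `SU(N)`,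
# every `d ≥ 2`, every torus, at `|b| < N/(8d)`: the plaquette expectation is `16N(d−1)/K`-Lipschitz in the coupling UNIFORMLY IN THE VOLUME,
# and `|⟨Re Tr Q_p⟩_b| ≤ 16N(d−1)|b|/(N/2 − 4d|b|)` (volume-uniform `O(b)`)

Seat `ym-line-csu-p1` (g39), route `ColdStartUniversality` of `Summits/QuantumFields/YangMills`, helper file G28 (strong coupling;
`--supports stmt-QuantumFields-24809`).  The tree's Feynman–Hellmann identity for Wilson's torus measure (`hasDerivAt_integral_wilsonMeasure_eq_neg_covariance`,
`d/db ∫F dμ_b = −Cov_b(F, S_W)`) says that the `b`-derivative of the plaquette expectation is the plaquette SUSCEPTIBILITY `Σ_q Cov_b(Re Tr Q_p, Re Tr Q_q)`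
(`S_W = Σ_q (N − Re Tr Q_q)`); G22 bounds it by `0 ≤ · ≤ 16N(d−1)/K`, `K = N/2 − 4d|b|`, uniformly in `L` (tree coupling `b = Nβ`).  So on the strong-coupling
window the mean plaquette — Montvay–Münster's internal energy — has a volume-uniform Lipschitz constant in the coupling (bounded specific heat per
plaquette: no first-order signature there), and is `O(b)` uniformly in the volume (g31 had `SU(2)`, `d = 3` via the dynamics).  The tree already knows
monotonicity in `b` (convexity, `WilsonEnergyStrictMonotone`) and positivity for `b > 0` (`WilsonPlaquettePositivity`), both NON-uniformly.

* §1 (every compact second-countable `G`, continuous `ρ`, every `b`, `L`) ★★ `hasDerivAt_plaquetteExpectation` — `d/db ∫ Re Tr ρ(U_p) dμ_b = Σ_q Cov_{μ_b}(Re Tr ρ(U_p), Re Tr ρ(U_q))`.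
* §2 (`SU(N)`) `plaquetteSusceptibility_bounds_sun` (G22 at tree coupling `b`); ★★★ `plaquetteExpectation_lipschitz_sun` — for `|b₁|, |b₂| ≤ b₀ < N/(8d)`:
  `|E(b₂) − E(b₁)| ≤ (16N(d−1)/(N/2 − 4d b₀))·|b₂ − b₁|`, every `L`; `plaquetteExpectation_zero_sun`
  (`E(0) = 0`, `N ≥ 2`, `L ≥ 2`); ★★★ `abs_plaquetteExpectation_le_sun` — `|⟨Re Tr Q_p⟩_b| ≤ 16N(d−1)|b|/(N/2 − 4d|b|)`, every `L ≥ 2`.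

THEOREMS ONLY, no definition, no sorry.  HONEST FRAMING: STRONG coupling, FIXED finite tori (bounds uniform in `L`); nothing at weak coupling / in the
continuum, nothing `K`-uniform along the route's scaling (`UniformColdStartMixing`, 24809, ASIDE, not restated); no crux, rung or summit statement is
proved; the Yang–Mills mass gap is NOT proved.

References: B. Simon, *The Statistical Mechanics of Lattice Gases* I (1993) §II.1 (Feynman–Hellmann); I. Montvay, G. Münster (1994) §3.2 (3.113);
H. Shen, R. Zhu, X. Zhu, CMP 400 (2023), Cor. 4.8 [ShenZhuZhu2022].
-/

set_option autoImplicit false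

noncomputable section

namespace Summit.QuantumFields.YangMills.Theorems.ColdStartUniversality

open MeasureTheory ProbabilityTheory Finset Filter Set Function
open scoped BigOperators NNReal ENNReal Topology Matrix
open Literature.MathematicalPhysics.QuantumFieldTheory
open Literature.MathematicalPhysics.QuantumLattice (fundamentalRep continuous_fundamentalRep fundamentalRep_apply suCenter coe_suCenter centerPhase
  hasDerivAt_integral_wilsonMeasure_eq_neg_covariance)
open Literature.MathematicalPhysics.QuantumFieldTheory.SUNBakryEmery (SUN)
open Literature.Barriers.QuantumFields (plaquetteReTrace continuous_plaquetteReTrace)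

/-! ## §1. Feynman–Hellmann: the derivative of the plaquette expectation is the plaquette susceptibility -/

section General

variable {d L N : ℕ} [NeZero L] {G : Type*} [Group G] [TopologicalSpace G] [IsTopologicalGroup G] [CompactSpace G]
  [MeasurableSpace G] [BorelSpace G] [SecondCountableTopology G] (ρ : G →* Matrix (Fin N) (Fin N) ℂ)

/-- ★★ **Feynman–Hellmann for the plaquette**: for every compact gauge group, continuous `ρ`, every torus and EVERY real coupling `b`,
`d/db ∫ Re Tr ρ(U_p) d(wilsonMeasure ρ b) = Σ_q Cov_{wilsonMeasure ρ b}(Re Tr ρ(U_p), Re Tr ρ(U_q))` — the Wilson action `S_W = Σ_q (N − Re Tr ρ(U_q))` is conjugate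
to the coupling (tree `hasDerivAt_integral_wilsonMeasure_eq_neg_covariance`), and `−Cov(P_p, S_W) = Σ_q Cov(P_p, P_q)`. [folklore] -/
theorem hasDerivAt_plaquetteExpectation (hρ : Continuous ρ) (p : Plaquette d L) (b : ℝ) :
    HasDerivAt (fun b' : ℝ => ∫ U, plaquetteReTrace ρ p U ∂(wilsonMeasure (d := d) (L := L) ρ b'))
      (∑ q, cov[plaquetteReTrace ρ p, plaquetteReTrace ρ q; wilsonMeasure (d := d) (L := L) ρ b]) b := by
  haveI : IsProbabilityMeasure (wilsonMeasure (d := d) (L := L) ρ b) := isProbabilityMeasure_wilsonMeasure ρ hρ b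
  obtain ⟨C, -, hC⟩ := exists_bound_trace_re_nonneg ρ hρ
  have hm : Measurable (plaquetteReTrace (d := d) (L := L) (G := G) ρ p) :=
    (continuous_trace_re ρ hρ).measurable.comp (measurable_plaquetteHolonomy _ _ _)
  have h := hasDerivAt_integral_wilsonMeasure_eq_neg_covariance (d := d) (L := L) (ρ := ρ) (C := C) hρ hm.aestronglyMeasurable
    (ae_of_all _ fun U => by rw [Real.norm_eq_abs]; exact hC _) b
  -- `Cov(P_p, S_W) = −Σ_q Cov(P_p, P_q)`
  have hS : (fun U : GaugeConfig d L G => wilsonAction ρ U) = fun U => (N : ℝ) * (Fintype.card (Plaquette d L) : ℝ) - ∑ q, plaquetteReTrace ρ q U := by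
    funext U
    simp only [wilsonAction, plaquetteReTrace, Finset.sum_sub_distrib, Finset.sum_const, Finset.card_univ, nsmul_eq_mul]
    ring
  have hint : Integrable (fun U : GaugeConfig d L G => ∑ q, plaquetteReTrace ρ q U) (wilsonMeasure (d := d) (L := L) ρ b) :=
    integrable_finsetSum _ fun q _ => (memLp_two_plaquetteReTrace ρ hρ q _).integrable one_le_two
  have hcov : cov[plaquetteReTrace ρ p, fun U => wilsonAction ρ U; wilsonMeasure (d := d) (L := L) ρ b] =
      -∑ q, cov[plaquetteReTrace ρ p, plaquetteReTrace ρ q; wilsonMeasure (d := d) (L := L) ρ b] := by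
    rw [hS, covariance_const_sub_right hint, covariance_fun_sum_right (fun q => memLp_two_plaquetteReTrace ρ hρ q _)
      (memLp_two_plaquetteReTrace ρ hρ p _)]
  rw [hcov, neg_neg] at h
  exact h

end General

/-! ## §2. `SU(N)`: volume-uniform Lipschitz continuity and size of the plaquette expectation at strong coupling -/

section SUN

variable {d N L : ℕ} [NeZero L]

/-- G22's susceptibility bounds at tree coupling `b`: `0 ≤ Σ_q Cov_b(Re Tr Q_p, Re Tr Q_q) ≤ 16N(d−1)/(N/2 − 4d|b|)` for `|b| < N/(8d)`.
[cite: ShenZhuZhu2022, Corollary 4.8] -/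
theorem plaquetteSusceptibility_bounds_sun (hN : N ≠ 0) {b : ℝ} (hK : 0 < (N : ℝ) / 2 - 4 * d * |b|) (p : Plaquette d L) :
    0 ≤ ∑ q, cov[plaquetteReTrace (fundamentalRep (Fin N)) p, plaquetteReTrace (fundamentalRep (Fin N)) q;
        wilsonMeasure (d := d) (L := L) (fundamentalRep (Fin N)) b] ∧
    ∑ q, cov[plaquetteReTrace (fundamentalRep (Fin N)) p, plaquetteReTrace (fundamentalRep (Fin N)) q;
        wilsonMeasure (d := d) (L := L) (fundamentalRep (Fin N)) b] ≤ 16 * N * ((d : ℝ) - 1) / ((N : ℝ) / 2 - 4 * d * |b|) := by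
  have hN' : (N : ℝ) ≠ 0 := Nat.cast_ne_zero.2 hN
  have hNpos : (0 : ℝ) < N := by positivity
  have hb : (N : ℝ) * (b / N) = b := mul_div_cancel₀ b hN'
  have hK' : (N : ℝ) / 2 - N * |b / N| * (4 * d) = (N : ℝ) / 2 - 4 * d * |b| := by
    rw [abs_div, abs_of_pos hNpos]; field_simp
  have h := torus_plaquetteSusceptibility_sun (d := d) (L := L) hN (β := b / N) (by rw [hK']; exact hK) p
  rw [hb, hK'] at h
  exact h

/-- ★★★ **The plaquette expectation is Lipschitz in the coupling UNIFORMLY IN THE VOLUME at strong coupling, every `SU(N)`, every `d`**: for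
`N/2 − 4d b₀ > 0` and `|b₁|, |b₂| ≤ b₀`, on every torus `(ℤ/L)^d`,
`|∫ Re Tr Q_p dμ_{b₂} − ∫ Re Tr Q_p dμ_{b₁}| ≤ (16N(d−1)/(N/2 − 4d b₀))·|b₂ − b₁|`  (mean value theorem; the derivative is the susceptibility).
The Yang–Mills mass gap is NOT proved. [cite: ShenZhuZhu2022, Corollary 4.8] -/
theorem plaquetteExpectation_lipschitz_sun (hd : 1 ≤ d) (hN : N ≠ 0) {b₀ : ℝ} (hK : 0 < (N : ℝ) / 2 - 4 * d * b₀)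
    (p : Plaquette d L) {b₁ b₂ : ℝ} (h₁ : |b₁| ≤ b₀) (h₂ : |b₂| ≤ b₀) :
    |(∫ U, plaquetteReTrace (fundamentalRep (Fin N)) p U ∂(wilsonMeasure (d := d) (L := L) (fundamentalRep (Fin N)) b₂)) -
        ∫ U, plaquetteReTrace (fundamentalRep (Fin N)) p U ∂(wilsonMeasure (d := d) (L := L) (fundamentalRep (Fin N)) b₁)| ≤
      16 * N * ((d : ℝ) - 1) / ((N : ℝ) / 2 - 4 * d * b₀) * |b₂ - b₁| := by
  haveI : SecondCountableTopology (Matrix (Fin N) (Fin N) ℂ) := inferInstanceAs (SecondCountableTopology (Fin N → Fin N → ℂ))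
  haveI : SecondCountableTopology (SUN N) := Topology.IsEmbedding.subtypeVal.secondCountableTopology
  have hd' : (1 : ℝ) ≤ d := by exact_mod_cast hd
  have hN' : (1 : ℝ) ≤ N := by exact_mod_cast Nat.one_le_iff_ne_zero.2 hN
  set s : Set ℝ := Set.Icc (-b₀) b₀ with hs
  have hmem : ∀ {b : ℝ}, |b| ≤ b₀ → b ∈ s := fun hb => ⟨by linarith [(abs_le.1 hb).1], (abs_le.1 hb).2⟩
  have key := Convex.norm_image_sub_le_of_norm_hasDerivWithin_le (𝕜 := ℝ)
    (f := fun b' : ℝ => ∫ U, plaquetteReTrace (fundamentalRep (Fin N)) p U ∂(wilsonMeasure (d := d) (L := L) (fundamentalRep (Fin N)) b'))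
    (f' := fun b' => ∑ q, cov[plaquetteReTrace (fundamentalRep (Fin N)) p, plaquetteReTrace (fundamentalRep (Fin N)) q;
        wilsonMeasure (d := d) (L := L) (fundamentalRep (Fin N)) b'])
    (s := s) (C := 16 * N * ((d : ℝ) - 1) / ((N : ℝ) / 2 - 4 * d * b₀))
    (fun b' _ => (hasDerivAt_plaquetteExpectation (fundamentalRep (Fin N)) (continuous_fundamentalRep (Fin N)) p b').hasDerivWithinAt)
    (fun b' hb' => by
      have hb'abs : |b'| ≤ b₀ := abs_le.2 ⟨hb'.1, hb'.2⟩
      have hKb : 0 < (N : ℝ) / 2 - 4 * d * |b'| := by nlinarith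
      obtain ⟨h0, h1⟩ := plaquetteSusceptibility_bounds_sun (d := d) (L := L) hN hKb p
      rw [Real.norm_eq_abs, abs_of_nonneg h0]
      refine h1.trans (div_le_div_of_nonneg_left (by nlinarith) hK (by nlinarith)))
    (convex_Icc _ _) (hmem h₁) (hmem h₂)
  rw [Real.norm_eq_abs, Real.norm_eq_abs] at key
  exact key

/-- **`⟨Re Tr Q_p⟩_0 = 0`** for `SU(N)`, `N ≥ 2`, on every torus with `L ≥ 2` (product Haar measure; the centre element `e^{2πi/N}·1` acts by a scalar
`≠ 1`, tree `integral_re_trace_plaquetteHolonomy_eq_zero`). [folklore] -/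
theorem plaquetteExpectation_zero_sun (hN : 2 ≤ N) (hL : 1 < L) (p : Plaquette d L) :
    ∫ U, plaquetteReTrace (fundamentalRep (Fin N)) p U ∂(wilsonMeasure (d := d) (L := L) (fundamentalRep (Fin N)) 0) = 0 := by
  haveI : Fact (1 < L) := ⟨hL⟩
  rw [Literature.MathematicalPhysics.QuantumLattice.wilsonMeasure_zero]
  have hω : fundamentalRep (Fin N) ((suCenter N 1 : Matrix.specialUnitaryGroup (Fin N) ℂ)) = centerPhase N 1 • (1 : Matrix (Fin N) (Fin N) ℂ) := by
    rw [fundamentalRep_apply, coe_suCenter]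
  haveI : NeZero N := ⟨by omega⟩
  have hne : centerPhase N 1 ≠ 1 := (Literature.MathematicalPhysics.QuantumLattice.isPrimitiveRoot_centerPhase N isUnit_one).ne_one hN
  exact integral_re_trace_plaquetteHolonomy_eq_zero (fundamentalRep (Fin N)) (continuous_fundamentalRep (Fin N)) hω hne p.1 (ne_of_lt p.2.2)

/-- ★★★ **The plaquette expectation is `O(b)` UNIFORMLY IN THE VOLUME at strong coupling, every `SU(N)` (`N ≥ 2`), every `d`**: for `|b| < N/(8d)` and
every torus with `L ≥ 2`,  `|⟨Re Tr Q_p⟩_{Λ_L, b}| ≤ 16N(d−1)|b|/(N/2 − 4d|b|)`.  (g31 had `SU(2)`, `d = 3` via the Langevin dynamics.)  The Yang–Mills mass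
gap is NOT proved. [cite: ShenZhuZhu2022, Corollary 4.8] -/
theorem abs_plaquetteExpectation_le_sun (hd : 1 ≤ d) (hN : 2 ≤ N) (hL : 1 < L) {b : ℝ} (hK : 0 < (N : ℝ) / 2 - 4 * d * |b|) (p : Plaquette d L) :
    |∫ U, plaquetteReTrace (fundamentalRep (Fin N)) p U ∂(wilsonMeasure (d := d) (L := L) (fundamentalRep (Fin N)) b)| ≤
      16 * N * ((d : ℝ) - 1) * |b| / ((N : ℝ) / 2 - 4 * d * |b|) := by
  have h := plaquetteExpectation_lipschitz_sun (d := d) (L := L) hd (by omega) hK p (b₁ := 0) (b₂ := b)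
    (by rw [abs_zero]; exact abs_nonneg b) le_rfl
  rw [plaquetteExpectation_zero_sun (d := d) (L := L) hN hL p, sub_zero, sub_zero] at h
  rw [mul_div_right_comm]
  exact h

end SUN

end Summit.QuantumFields.YangMills.Theorems.ColdStartUniversality

end
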